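import Summits.PneNP.PneNP.Theorems.KarlinRubinMonotoneSufficesGreedyLocality

/-!
# Crux `MonotoneSuffices` (stmt-PneNP-18026), the GREEDY general detector — part 5: the two errors of one trial

Per-`n`, per-trial counting bounds (candidate table `c : Fin t → Fin M → Fin n`, `W` = its `≤ tM` candidates):

* `card_trialOut_le` (null) — if `(1+η) n 2^{-t} ≤ θ` then the inputs accepted by the trial number at most
  `2^{#E} exp(-η² (n - tM) 2^{-t}/4)`: whatever `t`-set `T ⊆ W` the run picks, the common neighbours of `T`
  among the `≥ n - tM` non-candidates are `Bin(·, 2^{-t})` in the edges NOT read by the run (parts 3–4) — the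
  Chernoff upper tail of the room theorem (`Room.card_cnt_ge_le`);
* `card_verify_plant_ge` — under planting on `A ⊇ T`, the count of `T` is at least `#(A ∖ W)` plus the noise
  count over the vertices outside `W ∪ A`;
* `card_runsInto_not_trialOut_le` (planted) — hence, if `#(A ∖ W) ≥ a₀` and `θ - a₀ ≤ (1-η₁)(n - tM - #A) 2^{-t}`,
  the noise inputs `z` for which the trial runs into a subset of `A` on `plant A z` and yet REJECTS number at most
  `2^{#E} exp(-η₁² (n - tM - #A) 2^{-t}/4)` (Chernoff lower tail, `Room.card_filter_cnt_le_le_exp`).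
-/

set_option linter.dupNamespace false -- `Summit.PneNP.PneNP.…`: summit = sub-problem name (D-0017 single-conjunct layout)

namespace Summit.PneNP.PneNP.Theorems.MonotoneSuffices.Greedy

open Finset Real
open Literature.Probability.RandomGraphs.PlantedClique
open Summit.PneNP.PneNP.Theorems.MonotoneSuffices.Room

variable {n t M : ℕ}

/-! ### Null: the accepted inputs of one trial -/

/-- **Null error of one trial.** If `0 ≤ η ≤ 2`, `tM ≤ n` and `(1+η) n 2^{-t} ≤ θ`, the inputs accepted by the
trial number at most `2^{#E} exp(-η² (n - tM) 2^{-t} / 4)`. [folklore] -/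
theorem card_trialOut_le (c : Fin t → Fin M → Fin n) (θ : ℕ) {η : ℝ} (hη : 0 ≤ η) (hη2 : η ≤ 2)
    (htM : t * M ≤ n) (hθ : (1 + η) * ((n : ℝ) * (2 : ℝ)⁻¹ ^ t) ≤ θ) :
    (#((univ : Finset (EdgeVec n)).filter fun x => trialOut x c θ = true) : ℝ) ≤
      2 ^ Fintype.card (⊤ : SimpleGraph (Fin n)).edgeSet *
        Real.exp (-(η ^ 2 * (((n - t * M : ℕ) : ℝ) * (2 : ℝ)⁻¹ ^ t) / 4)) := by
  classical
  set r : ℝ := 2 ^ Fintype.card (⊤ : SimpleGraph (Fin n)).edgeSet *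
    Real.exp (-(η ^ 2 * (((n - t * M : ℕ) : ℝ) * (2 : ℝ)⁻¹ ^ t) / 4)) with hr
  have hr0 : 0 ≤ r := by positivity
  suffices h : #((univ : Finset (EdgeVec n)).filter fun x => trialOut x c θ = true) ≤ ⌊r⌋₊ from
    le_trans (by exact_mod_cast h) (Nat.floor_le hr0)
  refine card_trialOut_le_of_forall c θ ⌊r⌋₊ fun T hTW hTt => Nat.le_floor ?_
  -- the count of `T` over the non-candidates `U`
  set U : Finset (Fin n) := univ \ candSet c with hU
  have hUT : ∀ u ∈ U, u ∉ T := fun u hu h => (mem_sdiff.1 hu).2 (hTW h)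
  have hUn : #U ≤ n := by simpa using card_le_univ U
  have hUge : n - t * M ≤ #U := by
    rw [hU, card_univ_sdiff, Fintype.card_fin]
    have := card_candSet_le c
    omega
  have hcnt := card_cnt_ge_le T U hUT hη hη2
  rw [hTt] at hcnt
  -- `θ ≤ cnt` implies the Chernoff event `(1+η) #U 2^{-t} ≤ cnt`
  have hsub : ((univ : Finset (EdgeVec n)).filter fun x => θ ≤ #(U.filter (AdjAll x T))) ⊆
      (univ : Finset (EdgeVec n)).filter fun x => (1 + η) * (#U * (2 : ℝ)⁻¹ ^ t) ≤
        (#(U.filter fun u => ∀ e ∈ (univ.filter fun e : (⊤ : SimpleGraph (Fin n)).edgeSet =>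
          ∃ w ∈ T, (e : Sym2 (Fin n)) = s(u, w)), x e = true) : ℝ) := by
    intro x hx
    rw [mem_filter] at hx ⊢
    refine ⟨mem_univ _, ?_⟩
    have hUreal : (#U : ℝ) ≤ n := by exact_mod_cast hUn
    have h1 : (1 + η) * (#U * (2 : ℝ)⁻¹ ^ t) ≤ (1 + η) * ((n : ℝ) * (2 : ℝ)⁻¹ ^ t) :=
      mul_le_mul_of_nonneg_left (mul_le_mul_of_nonneg_right hUreal (by positivity)) (by linarith)
    have h2 : (θ : ℝ) ≤ #(U.filter (AdjAll x T)) := by exact_mod_cast hx.2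
    exact h1.trans (hθ.trans h2)
  calc (#((univ : Finset (EdgeVec n)).filter fun x => θ ≤ #(U.filter (AdjAll x T))) : ℝ)
      ≤ #((univ : Finset (EdgeVec n)).filter fun x => (1 + η) * (#U * (2 : ℝ)⁻¹ ^ t) ≤
          (#(U.filter fun u => ∀ e ∈ (univ.filter fun e : (⊤ : SimpleGraph (Fin n)).edgeSet =>
            ∃ w ∈ T, (e : Sym2 (Fin n)) = s(u, w)), x e = true) : ℝ)) := by exact_mod_cast card_le_card hsub
    _ ≤ 2 ^ Fintype.card (⊤ : SimpleGraph (Fin n)).edgeSet * Real.exp (-(η ^ 2 * (#U * (2 : ℝ)⁻¹ ^ t) / 4)) := hcnt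
    _ ≤ r := by
        rw [hr]
        refine mul_le_mul_of_nonneg_left (Real.exp_le_exp.2 ?_) (by positivity)
        have hUge' : ((n - t * M : ℕ) : ℝ) ≤ #U := by exact_mod_cast hUge
        have h2t : (0 : ℝ) ≤ (2 : ℝ)⁻¹ ^ t := by positivity
        nlinarith [mul_le_mul_of_nonneg_right hUge' h2t, sq_nonneg η]

/-! ### Planted: the count after planting -/

/-- **The count after planting.** For picks `T ⊆ A` inside the candidate set `W`, the common neighbours of `T` in
`plant A z` outside `W` include all of `A ∖ W` and every common neighbour of `T` in `z` outside `W ∪ A`. [folklore] -/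
theorem card_verify_plant_ge (A W T : Finset (Fin n)) (hTA : T ⊆ A) (z : EdgeVec n) :
    #(A \ W) + #((univ \ (W ∪ A)).filter (AdjAll z T)) ≤ #((univ \ W).filter (AdjAll (plant A z) T)) := by
  classical
  -- inside `A`: every star edge is planted
  have hin : ∀ v ∈ A \ W, AdjAll (plant A z) T v := by
    intro v hv e he
    obtain ⟨w, hw, hew⟩ := (mem_filter.1 he).2
    rw [plant_apply_eq, Bool.or_eq_true]
    refine Or.inr (decide_eq_true fun u hu => ?_)
    rw [hew, Sym2.mem_iff] at hu
    rcases hu with rfl | rfl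
    · exact (mem_sdiff.1 hv).1
    · exact hTA hw
  -- outside `A`: planting only adds edges
  have hout : ∀ v ∈ univ \ (W ∪ A), AdjAll z T v → AdjAll (plant A z) T v := by
    intro v _ h e he
    have := h e he
    rw [plant_apply_eq, this, Bool.true_or]
  have hdisj : Disjoint (A \ W) ((univ \ (W ∪ A)).filter (AdjAll z T)) := by
    rw [disjoint_left]
    intro v hv hv'
    have := (mem_sdiff.1 (mem_filter.1 hv').1).2
    exact this (mem_union_right _ (mem_sdiff.1 hv).1)
  rw [← card_union_of_disjoint hdisj]
  refine card_le_card fun v hv => ?_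
  rw [mem_union] at hv
  rw [mem_filter]
  rcases hv with hv | hv
  · exact ⟨mem_sdiff.2 ⟨mem_univ _, (mem_sdiff.1 hv).2⟩, hin v hv⟩
  · obtain ⟨hv1, hv2⟩ := mem_filter.1 hv
    exact ⟨mem_sdiff.2 ⟨mem_univ _, fun h => (mem_sdiff.1 hv1).2 (mem_union_left _ h)⟩, hout v hv1 hv2⟩

/-! ### Planted: running into `A` and yet rejecting -/

/-- **Planted error of one trial, noise part.** Let `0 ≤ η₁ ≤ 1`, `tM + #A ≤ n`, `a₀ ≤ #(A ∖ W)` and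
`θ - a₀ ≤ (1-η₁)(n - tM - #A) 2^{-t}`. Then the inputs `z` for which the trial runs into a subset of `A` on
`plant A z` but rejects number at most `2^{#E} exp(-η₁² (n - tM - #A) 2^{-t} / 4)`. [folklore] -/
theorem card_runsInto_not_trialOut_le (c : Fin t → Fin M → Fin n) (A : Finset (Fin n)) (θ a₀ : ℕ)
    {η₁ : ℝ} (hη₁ : 0 ≤ η₁) (hη₁1 : η₁ ≤ 1) (htM : t * M + #A ≤ n) (ha₀ : a₀ ≤ #(A \ candSet c))
    (hθ : (θ : ℝ) - a₀ ≤ (1 - η₁) * (((n - t * M - #A : ℕ) : ℝ) * (2 : ℝ)⁻¹ ^ t)) :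
    (#((univ : Finset (EdgeVec n)).filter fun z =>
        (∃ T ⊆ A, run (plant A z) c t = some T) ∧ trialOut (plant A z) c θ = false) : ℝ) ≤
      2 ^ Fintype.card (⊤ : SimpleGraph (Fin n)).edgeSet *
        Real.exp (-(η₁ ^ 2 * (((n - t * M - #A : ℕ) : ℝ) * (2 : ℝ)⁻¹ ^ t) / 4)) := by
  classical
  set W := candSet c with hW
  set U' : Finset (Fin n) := univ \ (W ∪ A) with hU'
  set r : ℝ := 2 ^ Fintype.card (⊤ : SimpleGraph (Fin n)).edgeSet *
    Real.exp (-(η₁ ^ 2 * (((n - t * M - #A : ℕ) : ℝ) * (2 : ℝ)⁻¹ ^ t) / 4)) with hr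
  have hr0 : 0 ≤ r := by positivity
  have hU'ge : n - t * M - #A ≤ #U' := by
    rw [hU', card_univ_sdiff, Fintype.card_fin]
    have h1 : #(W ∪ A) ≤ #W + #A := card_union_le _ _
    have h2 : #W ≤ t * M := card_candSet_le c
    omega
  -- the low-noise outside-event
  let Q : Finset (Fin n) → EdgeVec n → Prop := fun T z =>
    (#(U'.filter (AdjAll z T)) : ℝ) ≤ (1 - η₁) * (#U' * (2 : ℝ)⁻¹ ^ t)
  suffices h : #((univ : Finset (EdgeVec n)).filter fun z =>
      (∃ T ⊆ A, run (plant A z) c t = some T) ∧ trialOut (plant A z) c θ = false) ≤ ⌊r⌋₊ from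
    le_trans (by exact_mod_cast h) (Nat.floor_le hr0)
  refine le_trans (card_le_card ?_) (card_runsInto_and_le_of_forall c A Q ⌊r⌋₊ ?_ ?_)
  · -- rejecting despite an `A`-run forces low noise
    intro z hz
    rw [mem_filter] at hz ⊢
    obtain ⟨⟨T, hTA, hT⟩, hrej⟩ := hz.2
    refine ⟨mem_univ _, T, hTA, hT, ?_⟩
    have hTW : T ⊆ W := run_subset_candSet _ c t hT
    -- `¬ (θ ≤ count)`
    have hlt : ¬ θ ≤ #((univ \ W).filter (AdjAll (plant A z) T)) := by
      intro hle
      have := (trialOut_eq_true_iff (plant A z) c θ).2 ⟨T, hT, hle⟩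
      rw [this] at hrej
      cases hrej
    have hge := card_verify_plant_ge A W T hTA z
    have hnat : #(A \ W) + #(U'.filter (AdjAll z T)) + 1 ≤ θ := by rw [hU']; omega
    have hreal : (a₀ : ℝ) + #(U'.filter (AdjAll z T)) + 1 ≤ θ := by
      have h1 : ((#(A \ W) + #(U'.filter (AdjAll z T)) + 1 : ℕ) : ℝ) ≤ θ := by exact_mod_cast hnat
      have h2 : (a₀ : ℝ) ≤ #(A \ W) := by exact_mod_cast ha₀
      push_cast at h1
      linarith
    have hU'ge' : ((n - t * M - #A : ℕ) : ℝ) ≤ #U' := by exact_mod_cast hU'ge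
    have hmono : (1 - η₁) * (((n - t * M - #A : ℕ) : ℝ) * (2 : ℝ)⁻¹ ^ t) ≤ (1 - η₁) * (#U' * (2 : ℝ)⁻¹ ^ t) :=
      mul_le_mul_of_nonneg_left (mul_le_mul_of_nonneg_right hU'ge' (by positivity)) (by linarith)
    show (#(U'.filter (AdjAll z T)) : ℝ) ≤ (1 - η₁) * (#U' * (2 : ℝ)⁻¹ ^ t)
    linarith
  · -- `Q T` reads only edges not inside `W`
    intro T hTW z z' hzz'
    show (#(U'.filter (AdjAll z T)) : ℝ) ≤ _ ↔ (#(U'.filter (AdjAll z' T)) : ℝ) ≤ _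
    rw [hU', card_verify_congr_outside hTW subset_union_left hzz']
  · -- Chernoff lower tail for each possible pick set
    intro T hTW _ hTt
    refine Nat.le_floor ?_
    have hUT : ∀ u ∈ U', u ∉ T := fun u hu h => (mem_sdiff.1 hu).2 (mem_union_left _ (hTW h))
    have h := card_filter_cnt_le_le_exp (E := (⊤ : SimpleGraph (Fin n)).edgeSet) U'
      (fun u => univ.filter fun e : (⊤ : SimpleGraph (Fin n)).edgeSet => ∃ w ∈ T, (e : Sym2 (Fin n)) = s(u, w)) t
      (fun u hu => (card_star T (hUT u hu)).trans hTt) (pairwiseDisjoint_star T U' hUT) hη₁ (by linarith)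
    refine le_trans ?_ (h.trans ?_)
    · exact_mod_cast card_le_card fun z hz => by
        rw [mem_filter] at hz ⊢
        exact ⟨mem_univ _, hz.2⟩
    · rw [hr]
      refine mul_le_mul_of_nonneg_left (Real.exp_le_exp.2 ?_) (by positivity)
      have hU'ge' : ((n - t * M - #A : ℕ) : ℝ) ≤ #U' := by exact_mod_cast hU'ge
      have h2t : (0 : ℝ) ≤ (2 : ℝ)⁻¹ ^ t := by positivity
      nlinarith [mul_le_mul_of_nonneg_right hU'ge' h2t, sq_nonneg η₁]

end Summit.PneNP.PneNP.Theorems.MonotoneSuffices.Greedy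

namespace Summit.PneNP.PneNP.Theorems.MonotoneSuffices.Greedy

open Finset

/-- Registered sub-goal `greedy_errors` of stmt-PneNP-18026 (greedy detector, part 5): the null error of one
trial, exported verbatim. [folklore] -/
theorem greedy_errors :
    ∀ {n t M : ℕ} (c : Fin t → Fin M → Fin n) (θ : ℕ) {η : ℝ}, 0 ≤ η → η ≤ 2 → t * M ≤ n → (1 + η) * ((n : ℝ) * (2 : ℝ)⁻¹ ^ t) ≤ θ → (#((Finset.univ : Finset (Literature.Probability.RandomGraphs.PlantedClique.EdgeVec n)).filter fun x => Summit.PneNP.PneNP.Theorems.MonotoneSuffices.Greedy.trialOut x c θ = true) : ℝ) ≤ 2 ^ Fintype.card (⊤ : SimpleGraph (Fin n)).edgeSet * Real.exp (-(η ^ 2 * (((n - t * M : ℕ) : ℝ) * (2 : ℝ)⁻¹ ^ t) / 4)) :=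
  fun c θ _ hη hη2 htM hθ => card_trialOut_le c θ hη hη2 htM hθ

end Summit.PneNP.PneNP.Theorems.MonotoneSuffices.Greedy
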